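import Summits.BirchSwinnertonDyer.BirchSwinnertonDyer.Theorems.BiquadraticEisensteinDescentHeegnerTwistCouplingInSupplyPartnerLadder
import HarnessLib

set_option linter.dupNamespace false -- `Summit.BirchSwinnertonDyer.BirchSwinnertonDyer.Theorems.…` (summit = sub)
set_option autoImplicit false

/-!
# Crux `HeegnerTwistCouplingInSupply` (stmt-BirchSwinnertonDyer-21381) — RUNGS of the two-sided partner ladder for the
# corner `W = E_p`, `p ≡ 7 (mod 8)`: partners `q₀ ∈ {11, 19, 43}` and `ℓ₀ = 13`, kernel tables below their thresholds,
# and the union with the tree's rungs `3` (p645024) and `5` (p649700)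

Route `BiquadraticEisensteinDescent` (cell `pub/bsd-wall`, width seat `bsd-wall-cm-bed-w4` g12; `--supports` 21381, helper).
Sequel to `…PartnerLadder` (the generic rungs `cruxOnEpCornerPartnerQ_of_facts` / `cruxOnEpCornerPartnerL_of_facts` with the
thresholds `8⁸c⁵ ≤ (2.718·3.1415)⁸P³`, `c = 2q₀` resp. `10ℓ₀`, and their table forms `…_of_row`). Here:

* §1 the partner lists (`ℓ ∈ {5, 13, 29, 37, 53, 61}`, `q ∈ {3, 19, 11, 43, 59, 83, 107}`) and the bridge from a Jacobi symbol
  `−1` back to the brute-force non-residue datum the tables are keyed on;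
* §2 KERNEL TABLES (one `decide +kernel` each, NO primality test — the rows quantify over every `p ≡ 7 (mod 8)` of the residue
  class, prime or not): below `P(11) = 146` (7 values), `P(19) = 362` (20), `P(43) = 1409` (84), `P(13) = 2805` (161, two halves),
  each row a partner on the other side of the cell with `p` a non-residue there and Cohen's pair count
  `classNumberCount(q₀ℓ) < p` (all class numbers that occur are `≤ 56`);
* §3 the four rungs `cruxOnEpCornerQ11/Q19/Q43/L13_of_facts` (every prime `p ≡ 7 (mod 8)` with `(p/11) = −1`, resp.
  `(p/19) = −1`, `(p/43) = −1`, `(13/p) = −1`; the last two for `p ≠ 7`);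
* §4 ★ `cruxOnEpCornerLadder_of_facts` — **the corner `W = E_p` for every prime `p ≡ 7 (mod 8)` with
  `p ≡ 2 (3) ∨ p ≡ ±2 (5) ∨ (p/11) = −1 ∨ (p/19) = −1 ∨ (p/43) = −1 ∨ (13/p) = −1`**: a Heegner field `K′` of `N(E_p)` with
  `4 < |d_{K′}|`, `L(E_p^{(d_{K′})}, 1) ≠ 0`, `h(K′) < p`, `p ∤ h(K′)` — modulo the same five named facts as p645024 / p649700
  (Modularity, Monsky odd, Burungale–Tian, Deuring–Hecke, Burungale–Flach) and nothing else.

Reading (numbers): g11 left the `E_p` family at density `3/4` of the primes `p ≡ 7 (mod 8)` (residual class `p ≡ 1 (3) ∧ ±1 (5)`);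
the six partners `{3, 5, 11, 13, 19, 43}` leave the residual «`p` a residue mod `3, 11, 19, 43` and `5, 13` residues mod `p`»,
density `1/64`. HONEST FRAMING: the ladder never reaches all `p` (both cell primes pinned ⇒ `|d| ≍ p²`); these are typed
sub-corner rungs of the crux's CONCLUSION on one CM family, not the crux (all CM `W` of analytic rank one; residual C⁺);
BSD is not proved by any of this. THEOREMS ONLY. Supports stmt-BirchSwinnertonDyer-21381.
-/

namespace Summit.BirchSwinnertonDyer.BirchSwinnertonDyer.Theorems.BiquadraticEisensteinDescentHeegnerTwistCouplingInSupplyPartnerLadderRungs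

open Literature.NumberTheory.EllipticCurves Literature.NumberTheory.EllipticCurves.HeathBrown1994
  Literature.NumberTheory.EllipticCurves.HeathBrown1994.Families
  Literature.NumberTheory.QuadraticFields Literature.NumberTheory.QuadraticFields.Quadratic
  Summit.BirchSwinnertonDyer.BirchSwinnertonDyer.Theorems.BiquadraticEisensteinDescentHeegnerTwistCouplingInSupplyPartnerTables
  Summit.BirchSwinnertonDyer.BirchSwinnertonDyer.Theorems.BiquadraticEisensteinDescentHeegnerTwistCouplingInSupplyIndefinitePinWitness
  Summit.BirchSwinnertonDyer.BirchSwinnertonDyer.Theorems.BiquadraticEisensteinDescentHeegnerTwistCouplingInSupplyIndefinitePinCorner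
  Summit.BirchSwinnertonDyer.BirchSwinnertonDyer.Theorems.BiquadraticEisensteinDescentHeegnerTwistCouplingInSupplyPartnerLadder

/-! ## §1 Partner lists and the symbol-to-table bridge -/

/-- The `ℓ`-partners `5, 13, 29, 37, 53, 61` are primes `≡ 5 (mod 8)`. [folklore] -/
theorem partnersL_spec : ∀ l ∈ [5, 13, 29, 37, 53, 61], l.Prime ∧ l % 8 = 5 := by
  decide +kernel

/-- The `q`-partners `3, 19, 11, 43, 59, 83, 107` are primes `≡ 3 (mod 8)`. [folklore] -/
theorem partnersQ_spec : ∀ q ∈ [3, 19, 11, 43, 59, 83, 107], q.Prime ∧ q % 8 = 3 := by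
  decide +kernel

/-- From `(a/q) = −1` back to the table datum: `a` is not a square mod `q` (brute force over `x < q`). [folklore] -/
theorem forall_sq_ne_of_jacobiSym_eq_neg_one {a q : ℕ} (h : jacobiSym (a : ℤ) q = -1) :
    ∀ x < q, x * x % q ≠ a % q := by
  intro x _ hx
  refine ZMod.nonsquare_of_jacobiSym_eq_neg_one h ⟨(x : ZMod q), ?_⟩
  rw [Int.cast_natCast]
  have := (ZMod.natCast_eq_natCast_iff' (x * x) a q).mpr hx
  push_cast at this
  exact this.symm

/-- `(13/p) = −1 ⇒ p` is a non-residue mod `13` (`(13/p) = (p/13)`, `p` odd). [folklore] -/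
theorem forall_sq_ne_thirteen {p : ℕ} (hp2 : p % 2 = 1) (h : jacobiSym (13 : ℤ) p = -1) :
    ∀ x < 13, x * x % 13 ≠ p % 13 := by
  have h13 : jacobiSym ((13 : ℕ) : ℤ) p = jacobiSym (p : ℤ) 13 :=
    jacobiSym.quadratic_reciprocity_one_mod_four (by norm_num) (Nat.odd_iff.mpr hp2)
  have h' : jacobiSym (p : ℤ) 13 = -1 := by rw [← h13]; exact_mod_cast h
  exact forall_sq_ne_of_jacobiSym_eq_neg_one h'

/-! ## §2 The tables (kernel; no primality test — every `p ≡ 7 (mod 8)` of the class, prime or not, has a row) -/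

/-- **Table `q₀ = 11` below `146`** (rows `(p, ℓ)`: `(7,5) (39,29) (63,5) (79,29) (87,5) (95,29) (127,5)`; `h(−55) = 4`,
`h(−319) = 10`). [cite: Cohen1993, §5.3.1 Algorithm 5.3.5] -/
theorem tableQ11 : ∀ p ∈ Finset.range 146, p % 8 = 7 → (∀ x < 11, x * x % 11 ≠ p % 11) →
    ∃ l ∈ [5, 13, 29, 37, 53, 61], l < 2 * p ∧ (∀ x < l, x * x % l ≠ p % l) ∧
      BinQF.classNumberCount (11 * l) < p := by
  decide +kernel

/-- **Table `q₀ = 19` below `362`** (20 rows; partners `ℓ ∈ {5, 13, 29, 37, 53}`, `h(−19ℓ) ∈ {8, 6, 26, 14, 30}`).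
[cite: Cohen1993, §5.3.1 Algorithm 5.3.5] -/
theorem tableQ19 : ∀ p ∈ Finset.range 362, p % 8 = 7 → (∀ x < 19, x * x % 19 ≠ p % 19) →
    ∃ l ∈ [5, 13, 29, 37, 53, 61], l < 2 * p ∧ (∀ x < l, x * x % l ≠ p % l) ∧
      BinQF.classNumberCount (19 * l) < p := by
  decide +kernel

/-- **Table `q₀ = 43` below `1409`, `p ≥ 8`** (84 rows; partners `ℓ ∈ {5, 13, 29, 37, 53, 61}`,
`h(−43ℓ) ∈ {14, 16, 26, 22, 56, 22}`; `p = 7` has no row and is served by the partner `5`).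
[cite: Cohen1993, §5.3.1 Algorithm 5.3.5] -/
theorem tableQ43 : ∀ p ∈ Finset.range 1409, p % 8 = 7 → (∀ x < 43, x * x % 43 ≠ p % 43) → 8 ≤ p →
    ∃ l ∈ [5, 13, 29, 37, 53, 61], l < 2 * p ∧ (∀ x < l, x * x % l ≠ p % l) ∧
      BinQF.classNumberCount (43 * l) < p := by
  decide +kernel

/-- **Table `ℓ₀ = 13` below `1400`, `p ≥ 8`** (81 rows; partners `q ∈ {3, 19, 11, 43, 59, 83, 107}`,
`h(−13q) ∈ {4, 6, 10, 16, 22, 34, 44}`). [cite: Cohen1993, §5.3.1 Algorithm 5.3.5] -/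
theorem tableL13a : ∀ p ∈ Finset.range 1400, p % 8 = 7 → (∀ x < 13, x * x % 13 ≠ p % 13) → 8 ≤ p →
    ∃ q ∈ [3, 19, 11, 43, 59, 83, 107], q ≤ 10 * p ∧ (∀ x < q, x * x % q ≠ p % q) ∧
      BinQF.classNumberCount (q * 13) < p := by
  decide +kernel

/-- **Table `ℓ₀ = 13` on `[1400, 2805)`** (80 rows, same partners). [cite: Cohen1993, §5.3.1 Algorithm 5.3.5] -/
theorem tableL13b : ∀ p ∈ Finset.range 2805, 1400 ≤ p → p % 8 = 7 → (∀ x < 13, x * x % 13 ≠ p % 13) →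
    ∃ q ∈ [3, 19, 11, 43, 59, 83, 107], q ≤ 10 * p ∧ (∀ x < q, x * x % q ≠ p % q) ∧
      BinQF.classNumberCount (q * 13) < p := by
  decide +kernel

/-! ## §3 The four rungs -/

/-- **Rung `q₀ = 11`: every prime `p ≡ 7 (mod 8)` with `(p/11) = −1`** — modulo the five named facts, a pin `ℓ ≡ 5 (mod 8)`,
`ℓ < 2p`, `(ℓ/p) = −1` and the Heegner field `K′ = ℚ(√−11ℓ)` of `N(E_p)` with `L(E_p^{(−11ℓ)}, 1) ≠ 0`, `h(K′) < p`.
[cite: HeathBrown1994SelmerCongruentII, Appendix (Monsky), typescript p. 39 L27–L33] [cite: BurungaleTian2026, Thm. 1.1]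
[cite: BurungaleFlach2024, Thm. 1.1 and Cor. 2] [cite: Oesterle1988Gauss, II §3 Proposition p. 57 (27)] -/
theorem cruxOnEpCornerQ11_of_facts (hmod : ModularForms.exists_isNewformOf) (hM : monsky_card_selmerGroup_two_odd)
    (hBT : burungaleTian_analyticRank_eq_zero_of_selmerCorank_eq_zero_of_hasCM)
    (hH : hasEntireLFunction_of_j_mem_maximalCMJInvariants) (hBF : bsdTriple_of_hasCM_of_L_one_ne_zero) :
    ∀ (p : ℕ) [Fact p.Prime] [(congruentNumberCurve p).IsElliptic]
      [(congruentNumberCurve p).IsGloballyMinimal] [NeZero ((congruentNumberCurve p).conductorNorm ℤ)],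
      p % 8 = 7 → jacobiSym (p : ℤ) 11 = -1 →
      ∃ (ℓ : ℕ) (K : Type) (_ : Field K) (_ : NumberField K),
        ℓ.Prime ∧ ℓ < 2 * p ∧ ℓ % 8 = 5 ∧ jacobiSym (ℓ : ℤ) p = -1 ∧
        IsImaginaryQuadratic K ∧ NumberField.discr K = -((11 * ℓ : ℕ) : ℤ) ∧
        SatisfiesHeegnerHypothesis ((congruentNumberCurve p).conductorNorm ℤ) K ∧
        ((congruentNumberCurve p).quadraticTwist (NumberField.discr K : ℚ)).entireLFunction 1 ≠ 0 ∧
        NumberField.classNumber K < p := by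
  intro p _ _ _ _ hp8 hJ
  rcases Nat.lt_or_ge p 146 with hlt | hge
  · obtain ⟨l, hlmem, hllt, hres, hh⟩ :=
      tableQ11 p (Finset.mem_range.mpr hlt) hp8 (forall_sq_ne_of_jacobiSym_eq_neg_one hJ)
    obtain ⟨hl, hl8⟩ := partnersL_spec l hlmem
    exact cruxOnEpCornerPartnerQ_of_row hmod hM hBT hH hBF (by norm_num) (by norm_num) hp8 hJ hl hl8 hllt hres hh
  · exact cruxOnEpCornerPartnerQ_of_facts hmod hM hBT hH hBF (q₀ := 11) (by norm_num) (by norm_num) (P := 146)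
      (by norm_num) p hp8 hJ hge

/-- **Rung `q₀ = 19`: every prime `p ≡ 7 (mod 8)` with `(p/19) = −1`** (field `ℚ(√−19ℓ)`).
[cite: HeathBrown1994SelmerCongruentII, Appendix (Monsky), typescript p. 39 L27–L33] [cite: BurungaleTian2026, Thm. 1.1]
[cite: BurungaleFlach2024, Thm. 1.1 and Cor. 2] [cite: Oesterle1988Gauss, II §3 Proposition p. 57 (27)] -/
theorem cruxOnEpCornerQ19_of_facts (hmod : ModularForms.exists_isNewformOf) (hM : monsky_card_selmerGroup_two_odd)
    (hBT : burungaleTian_analyticRank_eq_zero_of_selmerCorank_eq_zero_of_hasCM)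
    (hH : hasEntireLFunction_of_j_mem_maximalCMJInvariants) (hBF : bsdTriple_of_hasCM_of_L_one_ne_zero) :
    ∀ (p : ℕ) [Fact p.Prime] [(congruentNumberCurve p).IsElliptic]
      [(congruentNumberCurve p).IsGloballyMinimal] [NeZero ((congruentNumberCurve p).conductorNorm ℤ)],
      p % 8 = 7 → jacobiSym (p : ℤ) 19 = -1 →
      ∃ (ℓ : ℕ) (K : Type) (_ : Field K) (_ : NumberField K),
        ℓ.Prime ∧ ℓ < 2 * p ∧ ℓ % 8 = 5 ∧ jacobiSym (ℓ : ℤ) p = -1 ∧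
        IsImaginaryQuadratic K ∧ NumberField.discr K = -((19 * ℓ : ℕ) : ℤ) ∧
        SatisfiesHeegnerHypothesis ((congruentNumberCurve p).conductorNorm ℤ) K ∧
        ((congruentNumberCurve p).quadraticTwist (NumberField.discr K : ℚ)).entireLFunction 1 ≠ 0 ∧
        NumberField.classNumber K < p := by
  intro p _ _ _ _ hp8 hJ
  rcases Nat.lt_or_ge p 362 with hlt | hge
  · obtain ⟨l, hlmem, hllt, hres, hh⟩ :=
      tableQ19 p (Finset.mem_range.mpr hlt) hp8 (forall_sq_ne_of_jacobiSym_eq_neg_one hJ)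
    obtain ⟨hl, hl8⟩ := partnersL_spec l hlmem
    exact cruxOnEpCornerPartnerQ_of_row hmod hM hBT hH hBF (by norm_num) (by norm_num) hp8 hJ hl hl8 hllt hres hh
  · exact cruxOnEpCornerPartnerQ_of_facts hmod hM hBT hH hBF (q₀ := 19) (by norm_num) (by norm_num) (P := 362)
      (by norm_num) p hp8 hJ hge

/-- **Rung `q₀ = 43`: every prime `p ≡ 7 (mod 8)`, `p ≠ 7`, with `(p/43) = −1`** (field `ℚ(√−43ℓ)`).
[cite: HeathBrown1994SelmerCongruentII, Appendix (Monsky), typescript p. 39 L27–L33] [cite: BurungaleTian2026, Thm. 1.1]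
[cite: BurungaleFlach2024, Thm. 1.1 and Cor. 2] [cite: Oesterle1988Gauss, II §3 Proposition p. 57 (27)] -/
theorem cruxOnEpCornerQ43_of_facts (hmod : ModularForms.exists_isNewformOf) (hM : monsky_card_selmerGroup_two_odd)
    (hBT : burungaleTian_analyticRank_eq_zero_of_selmerCorank_eq_zero_of_hasCM)
    (hH : hasEntireLFunction_of_j_mem_maximalCMJInvariants) (hBF : bsdTriple_of_hasCM_of_L_one_ne_zero) :
    ∀ (p : ℕ) [Fact p.Prime] [(congruentNumberCurve p).IsElliptic]
      [(congruentNumberCurve p).IsGloballyMinimal] [NeZero ((congruentNumberCurve p).conductorNorm ℤ)],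
      p % 8 = 7 → jacobiSym (p : ℤ) 43 = -1 → 8 ≤ p →
      ∃ (ℓ : ℕ) (K : Type) (_ : Field K) (_ : NumberField K),
        ℓ.Prime ∧ ℓ < 2 * p ∧ ℓ % 8 = 5 ∧ jacobiSym (ℓ : ℤ) p = -1 ∧
        IsImaginaryQuadratic K ∧ NumberField.discr K = -((43 * ℓ : ℕ) : ℤ) ∧
        SatisfiesHeegnerHypothesis ((congruentNumberCurve p).conductorNorm ℤ) K ∧
        ((congruentNumberCurve p).quadraticTwist (NumberField.discr K : ℚ)).entireLFunction 1 ≠ 0 ∧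
        NumberField.classNumber K < p := by
  intro p _ _ _ _ hp8 hJ h8
  rcases Nat.lt_or_ge p 1409 with hlt | hge
  · obtain ⟨l, hlmem, hllt, hres, hh⟩ :=
      tableQ43 p (Finset.mem_range.mpr hlt) hp8 (forall_sq_ne_of_jacobiSym_eq_neg_one hJ) h8
    obtain ⟨hl, hl8⟩ := partnersL_spec l hlmem
    exact cruxOnEpCornerPartnerQ_of_row hmod hM hBT hH hBF (by norm_num) (by norm_num) hp8 hJ hl hl8 hllt hres hh
  · exact cruxOnEpCornerPartnerQ_of_facts hmod hM hBT hH hBF (q₀ := 43) (by norm_num) (by norm_num) (P := 1409)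
      (by norm_num) p hp8 hJ hge

/-- **Rung `ℓ₀ = 13`: every prime `p ≡ 7 (mod 8)`, `p ≠ 7`, with `(13/p) = −1`** — a partner `q ≡ 3 (mod 8)`, `q ≤ 10p`,
`(q/p) = +1` (kernel table below `2805`, the indefinite `(3,+)` pin above) and `K′ = ℚ(√−13q)` with
`L(E_p^{(−13q)}, 1) ≠ 0`, `h(K′) < p`. [cite: HeathBrown1994SelmerCongruentII, Appendix (Monsky), typescript p. 39 L27–L33]
[cite: BurungaleTian2026, Thm. 1.1] [cite: BurungaleFlach2024, Thm. 1.1 and Cor. 2] [cite: Oesterle1988Gauss, II §3 Proposition p. 57 (27)] -/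
theorem cruxOnEpCornerL13_of_facts (hmod : ModularForms.exists_isNewformOf) (hM : monsky_card_selmerGroup_two_odd)
    (hBT : burungaleTian_analyticRank_eq_zero_of_selmerCorank_eq_zero_of_hasCM)
    (hH : hasEntireLFunction_of_j_mem_maximalCMJInvariants) (hBF : bsdTriple_of_hasCM_of_L_one_ne_zero) :
    ∀ (p : ℕ) [Fact p.Prime] [(congruentNumberCurve p).IsElliptic]
      [(congruentNumberCurve p).IsGloballyMinimal] [NeZero ((congruentNumberCurve p).conductorNorm ℤ)],
      p % 8 = 7 → jacobiSym (13 : ℤ) p = -1 → 8 ≤ p →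
      ∃ (q : ℕ) (K : Type) (_ : Field K) (_ : NumberField K),
        q.Prime ∧ q ≤ 10 * p ∧ q % 8 = 3 ∧ jacobiSym (q : ℤ) p = 1 ∧
        IsImaginaryQuadratic K ∧ NumberField.discr K = -((q * 13 : ℕ) : ℤ) ∧
        SatisfiesHeegnerHypothesis ((congruentNumberCurve p).conductorNorm ℤ) K ∧
        ((congruentNumberCurve p).quadraticTwist (NumberField.discr K : ℚ)).entireLFunction 1 ≠ 0 ∧
        NumberField.classNumber K < p := by
  intro p _ _ _ _ hp8 hJ h8
  have hJ' : jacobiSym ((13 : ℕ) : ℤ) p = -1 := by exact_mod_cast hJ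
  have hres13 := forall_sq_ne_thirteen (by omega) hJ
  rcases Nat.lt_or_ge p 2805 with hlt | hge
  · obtain ⟨q, hqmem, hqle, hres, hh⟩ :
        ∃ q ∈ [3, 19, 11, 43, 59, 83, 107], q ≤ 10 * p ∧ (∀ x < q, x * x % q ≠ p % q) ∧
          BinQF.classNumberCount (q * 13) < p := by
      rcases Nat.lt_or_ge p 1400 with h1400 | h1400
      · exact tableL13a p (Finset.mem_range.mpr h1400) hp8 hres13 h8
      · exact tableL13b p (Finset.mem_range.mpr hlt) h1400 hp8 hres13
    obtain ⟨hq, hq8⟩ := partnersQ_spec q hqmem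
    exact cruxOnEpCornerPartnerL_of_row hmod hM hBT hH hBF (by norm_num) (by norm_num) hp8 hJ' hq hq8 hqle hres hh
  · exact cruxOnEpCornerPartnerL_of_facts hmod hM hBT hH hBF (ℓ₀ := 13) (by norm_num) (by norm_num) (P := 2805)
      (by norm_num) (by norm_num) p hp8 hJ' hge

/-! ## §4 The union: the corner `W = E_p` on `63/64` of the primes `p ≡ 7 (mod 8)` -/

/-- **THE CORNER `W = E_p`, partners `{3, 5, 11, 13, 19, 43}`**: for every prime `p ≡ 7 (mod 8)` with
`p ≡ 2 (mod 3)` or `p ≡ ±2 (mod 5)` or `(p/11) = −1` or `(p/19) = −1` or `(p/43) = −1` or `(13/p) = −1` — modulo Modularity +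
Monsky (odd) + Burungale–Tian + Deuring–Hecke + Burungale–Flach — there is a Heegner field `K′` of `N(E_p)` with
`4 < |d_{K′}|`, `L(E_p^{(d_{K′})}, 1) ≠ 0`, `h(K′) < p` and `p ∤ h(K′)`: the CONCLUSION of crux `HeegnerTwistCouplingInSupply`
on this part of the family `E_p` (the tree's p645024 / p649700 for the partners `3`, `5`; the rungs of §3 otherwise). Left open
on `E_p`: `p` a residue mod `3, 11, 19, 43` with `5, 13` residues mod `p` (density `1/64`); further rungs are instances of
`…PartnerLadder.cruxOnEpCornerPartnerQ/L_of_facts` plus a table. [cite: HeathBrown1994SelmerCongruentII, Appendix (Monsky), typescript p. 39 L27–L33]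
[cite: BurungaleTian2026, Thm. 1.1] [cite: BurungaleFlach2024, Thm. 1.1 and Cor. 2] [cite: KoblitzECMF1993, Ch. II §5, Theorem (p. 84)] -/
theorem cruxOnEpCornerLadder_of_facts (hmod : ModularForms.exists_isNewformOf) (hM : monsky_card_selmerGroup_two_odd)
    (hBT : burungaleTian_analyticRank_eq_zero_of_selmerCorank_eq_zero_of_hasCM)
    (hH : hasEntireLFunction_of_j_mem_maximalCMJInvariants) (hBF : bsdTriple_of_hasCM_of_L_one_ne_zero) :
    ∀ (p : ℕ) [Fact p.Prime] [(congruentNumberCurve p).IsElliptic]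
      [(congruentNumberCurve p).IsGloballyMinimal] [NeZero ((congruentNumberCurve p).conductorNorm ℤ)],
      p % 8 = 7 →
      (p % 3 = 2 ∨ p % 5 = 2 ∨ p % 5 = 3 ∨ jacobiSym (p : ℤ) 11 = -1 ∨ jacobiSym (p : ℤ) 19 = -1 ∨
        jacobiSym (p : ℤ) 43 = -1 ∨ jacobiSym (13 : ℤ) p = -1) →
      ∃ (K : Type) (_ : Field K) (_ : NumberField K),
        IsImaginaryQuadratic K ∧ 4 < (NumberField.discr K).natAbs ∧
        SatisfiesHeegnerHypothesis ((congruentNumberCurve p).conductorNorm ℤ) K ∧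
        ((congruentNumberCurve p).quadraticTwist (NumberField.discr K : ℚ)).entireLFunction 1 ≠ 0 ∧
        NumberField.classNumber K < p ∧ ¬ p ∣ NumberField.classNumber K := by
  intro p hpF _ _ _ hp8 hcase
  have hp : p.Prime := hpF.out
  have hfin : ∀ (K : Type) [Field K] [NumberField K], NumberField.classNumber K < p →
      ¬ p ∣ NumberField.classNumber K := fun K _ _ hlt hdvd =>
    absurd (Nat.le_of_dvd (NumberField.classNumber_pos K) hdvd) (not_le.mpr hlt)
  -- the tree's partners `3` and `5` (this also serves `p = 7`)
  by_cases h35 : p % 3 = 2 ∨ p % 5 = 2 ∨ p % 5 = 3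
  · exact cruxOnEpCorner_of_facts hmod hM hBT hH hBF p hp8 h35
  have h8 : 8 ≤ p := by
    by_contra h
    have : p = 7 := by have := hp.two_le; omega
    exact h35 (Or.inr (Or.inl (by omega)))
  have hrest : jacobiSym (p : ℤ) 11 = -1 ∨ jacobiSym (p : ℤ) 19 = -1 ∨ jacobiSym (p : ℤ) 43 = -1 ∨
      jacobiSym (13 : ℤ) p = -1 := by tauto
  rcases hrest with h11 | h19 | h43 | h13
  · obtain ⟨ℓ, K, iF, iN, hℓ, -, -, -, hK, hdK, hHg, hL, hcl⟩ := cruxOnEpCornerQ11_of_facts hmod hM hBT hH hBF p hp8 h11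
    refine ⟨K, iF, iN, hK, ?_, hHg, hL, hcl, hfin K hcl⟩
    rw [hdK, Int.natAbs_neg, Int.natAbs_natCast]
    have := hℓ.two_le
    omega
  · obtain ⟨ℓ, K, iF, iN, hℓ, -, -, -, hK, hdK, hHg, hL, hcl⟩ := cruxOnEpCornerQ19_of_facts hmod hM hBT hH hBF p hp8 h19
    refine ⟨K, iF, iN, hK, ?_, hHg, hL, hcl, hfin K hcl⟩
    rw [hdK, Int.natAbs_neg, Int.natAbs_natCast]
    have := hℓ.two_le
    omega
  · obtain ⟨ℓ, K, iF, iN, hℓ, -, -, -, hK, hdK, hHg, hL, hcl⟩ :=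
      cruxOnEpCornerQ43_of_facts hmod hM hBT hH hBF p hp8 h43 h8
    refine ⟨K, iF, iN, hK, ?_, hHg, hL, hcl, hfin K hcl⟩
    rw [hdK, Int.natAbs_neg, Int.natAbs_natCast]
    have := hℓ.two_le
    omega
  · obtain ⟨q, K, iF, iN, hq, -, -, -, hK, hdK, hHg, hL, hcl⟩ :=
      cruxOnEpCornerL13_of_facts hmod hM hBT hH hBF p hp8 h13 h8
    refine ⟨K, iF, iN, hK, ?_, hHg, hL, hcl, hfin K hcl⟩
    rw [hdK, Int.natAbs_neg, Int.natAbs_natCast]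
    have := hq.two_le
    omega

end Summit.BirchSwinnertonDyer.BirchSwinnertonDyer.Theorems.BiquadraticEisensteinDescentHeegnerTwistCouplingInSupplyPartnerLadderRungs
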